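import Literature.Algebra.EuclideanLattices.SmoothingParameterBounds
import Mathlib.Probability.ProbabilityMassFunction.Integrals
import HarnessLib

/-!
# Above the smoothing parameter: two-sided mass bounds and MR07 Lemma 4.4 (tail of `D_{Λ,s,c}`) — proved

Topic `Algebra/EuclideanLattices` (family `pqc`), sequel of `SmoothingParameterBounds.lean`; serves the
decomposition of Micciancio–Regev 2007, Thm. 5.23
(`Literature.Computability.Cryptography.MicciancioRegev2007_gapCVP'_to_SIS'`), whose NO-case analysis
(authors' version p. 31, proof of eq. (17)) invokes **Lemma 4.4**: for `0 < ε < 1`, `s ≥ η_ε(Λ)` and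
any centre `c`, `Pr_{x ∼ D_{Λ,s,c}}[‖x - c‖ > s√n] ≤ (1+ε)/(1-ε) · 2⁻ⁿ`. Everything here is PROVED;
theorems only. Notation: `ρ_s = gaussianFunction s`, `n = finrank ℝ V`, `vol(L) = ZLattice.covolume L`,
`η_ε(L) = smoothingParameter L ε`, `D_{L,s,c} = discreteGaussian L s c` (`DiscreteGaussian.lean`).

## Results (full-rank lattice `L`, `0 < ε`, `0 < s`, `η_ε(L) ≤ s`)

* `tsum_gaussianFunction_sub_le_of_smoothingParameter_le`,
  `le_tsum_gaussianFunction_sub_of_smoothingParameter_le` — **the two-sided mass bounds**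
  `(1 - ε) sⁿ/vol(L) ≤ ρ_{s,c}(L) ≤ (1 + ε) sⁿ/vol(L)` (Micciancio–Regev 2007, proof of Lemma 4.4,
  p. 15: "`ρ_c(Λ) ≥ det(Λ*)(1 - ε)`, `ρ(Λ) ≤ det(Λ*)(1 + ε)`"; Regev 2009, Claim 3.8), read off the
  discharged fact `abs_gaussianMass_div_sub_one_le`; and the quotient form
  `ρ_s(L) ≤ (1+ε)/(1-ε) · ρ_{s,c}(L)` (`tsum_gaussianFunction_le_div_mul_tsum_sub`, `ε < 1`).
* `tsum_indicator_gaussianFunction_sub_le_of_smoothingParameter_le` — **MR07 Lemma 4.4, series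
  form**: `∑_{y ∈ L, ‖y - c‖ ≥ s√n} ρ_s(y - c) ≤ (1+ε)/(1-ε) · 2⁻ⁿ · ρ_{s,c}(L)` (the printed event is
  `‖x - c‖ > s√n`; the closed event `≥` is the stronger statement Banaszczyk's bound gives). Proof as
  printed: Banaszczyk's shifted tail bound `ρ_s((L - c) ∖ s√n B) ≤ 2⁻ⁿ ρ_s(L)`
  (`tsum_indicator_gaussianFunction_sub_le`, `GaussianLatticeTails.lean`) and the mass bounds.
* `integral_discreteGaussian_eq`, `measureReal_discreteGaussian_eq` — expectations and probabilities
  under `D_{L,s,c}` as normalised Gaussian series (for any centre; `DualGaussianSampling.lean` has the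
  centred dual case), and **MR07 Lemma 4.4, probability form**
  `measureReal_discreteGaussian_norm_sub_ge_le`: `D_{L,s,c} {x | ‖x - c‖ ≥ s√n} ≤ (1+ε)/(1-ε) · 2⁻ⁿ`.

## References

* D. Micciancio, O. Regev, *Worst-case to average-case reductions based on Gaussian measures*,
  SIAM J. Comput. 37 (2007) 267–302, Lemma 4.4 (authors' version p. 15), Lemma 2.10.
* O. Regev, *On lattices, learning with errors, random linear codes, and cryptography*, J. ACM 56
  (2009), Claim 3.8.
* W. Banaszczyk, *New bounds in some transference theorems in the geometry of numbers*,
  Math. Ann. 296 (1993), Lemma 1.5.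
-/

noncomputable section

open MeasureTheory Module Metric Filter
open scoped Real ENNReal InnerProductSpace Topology

namespace Literature.Algebra.EuclideanLattices

variable {V : Type*} [NormedAddCommGroup V] [InnerProductSpace ℝ V] [FiniteDimensional ℝ V]
  [MeasurableSpace V] [BorelSpace V]

variable (L : Submodule ℤ V) [DiscreteTopology L] [IsZLattice ℝ L]

/-! ### Two-sided mass bounds above the smoothing parameter -/

/-- **Upper mass bound above `η_ε`**: `ρ_{s,c}(L) ≤ (1 + ε) sⁿ/vol(L)` for `0 < ε`, `0 < s`,
`η_ε(L) ≤ s` (Micciancio–Regev 2007, proof of Lemma 4.4: "`ρ(Λ) ≤ det(Λ*)(1 + ε)`", here for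
every centre; Regev 2009, Claim 3.8). [cite: MicciancioRegev2007, Lemma 4.4 (proof, p. 15)] -/
theorem tsum_gaussianFunction_sub_le_of_smoothingParameter_le {ε s : ℝ} (hε : 0 < ε) (hs : 0 < s)
    (hηs : smoothingParameter L ε ≤ s) (c : V) :
    ∑' y : L, gaussianFunction s ((y : V) - c) ≤ (1 + ε) * (s ^ finrank ℝ V / ZLattice.covolume L) := by
  have h := abs_gaussianMass_div_sub_one_le_holds L hε hs hηs c
  rw [gaussianMass_coe_eq_ofReal_tsum L hs.ne' c,
    ENNReal.toReal_ofReal (tsum_nonneg fun _ ↦ (gaussianFunction_pos _ _).le)] at h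
  have hD : 0 < s ^ finrank ℝ V / ZLattice.covolume L :=
    div_pos (pow_pos hs _) (ZLattice.covolume_pos L volume)
  have h2 := (abs_le.1 h).2
  rw [sub_le_iff_le_add, div_le_iff₀ hD] at h2
  linarith

/-- **Lower mass bound above `η_ε`**: `(1 - ε) sⁿ/vol(L) ≤ ρ_{s,c}(L)` for `0 < ε`, `0 < s`,
`η_ε(L) ≤ s` and every centre `c` (Micciancio–Regev 2007, proof of Lemma 4.4:
"`ρ_c(Λ) ≥ det(Λ*)(1 - ε)`"; Regev 2009, Claim 3.8). [cite: MicciancioRegev2007, Lemma 4.4 (proof, p. 15)] -/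
theorem le_tsum_gaussianFunction_sub_of_smoothingParameter_le {ε s : ℝ} (hε : 0 < ε) (hs : 0 < s)
    (hηs : smoothingParameter L ε ≤ s) (c : V) :
    (1 - ε) * (s ^ finrank ℝ V / ZLattice.covolume L) ≤ ∑' y : L, gaussianFunction s ((y : V) - c) := by
  have h := abs_gaussianMass_div_sub_one_le_holds L hε hs hηs c
  rw [gaussianMass_coe_eq_ofReal_tsum L hs.ne' c,
    ENNReal.toReal_ofReal (tsum_nonneg fun _ ↦ (gaussianFunction_pos _ _).le)] at h
  have hD : 0 < s ^ finrank ℝ V / ZLattice.covolume L :=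
    div_pos (pow_pos hs _) (ZLattice.covolume_pos L volume)
  have h1 := (abs_le.1 h).1
  rw [le_sub_iff_add_le, le_div_iff₀ hD] at h1
  linarith

/-- **Shifting the centre costs at most `(1+ε)/(1-ε)` above `η_ε`**: `ρ_s(L) ≤ (1+ε)/(1-ε) · ρ_{s,c}(L)`
for `0 < ε < 1`, `0 < s`, `η_ε(L) ≤ s` (Micciancio–Regev 2007, proof of Lemma 4.4:
"`2⁻ⁿ ρ(Λ)/ρ_c(Λ) ≤ 2⁻ⁿ (1+ε)/(1-ε)`"). [cite: MicciancioRegev2007, Lemma 4.4 (proof, p. 15)] -/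
theorem tsum_gaussianFunction_le_div_mul_tsum_sub {ε s : ℝ} (hε : 0 < ε) (hε1 : ε < 1) (hs : 0 < s)
    (hηs : smoothingParameter L ε ≤ s) (c : V) :
    ∑' y : L, gaussianFunction s (y : V) ≤ (1 + ε) / (1 - ε) * ∑' y : L, gaussianFunction s ((y : V) - c) := by
  have hup := tsum_gaussianFunction_sub_le_of_smoothingParameter_le L hε hs hηs 0
  simp only [sub_zero] at hup
  have hlow := le_tsum_gaussianFunction_sub_of_smoothingParameter_le L hε hs hηs c
  have h1ε : 0 < 1 - ε := by linarith
  calc ∑' y : L, gaussianFunction s (y : V) ≤ (1 + ε) * (s ^ finrank ℝ V / ZLattice.covolume L) := hup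
    _ = (1 + ε) / (1 - ε) * ((1 - ε) * (s ^ finrank ℝ V / ZLattice.covolume L)) := by
        field_simp
    _ ≤ (1 + ε) / (1 - ε) * ∑' y : L, gaussianFunction s ((y : V) - c) :=
        mul_le_mul_of_nonneg_left hlow (div_nonneg (by linarith) h1ε.le)

/-! ### MR07 Lemma 4.4, series form -/

/-- **Micciancio–Regev 2007, Lemma 4.4 (series form)**: for a full-rank lattice `L` in dimension
`n`, `0 < ε < 1`, `0 < s` with `η_ε(L) ≤ s`, and any centre `c`,
`∑_{y ∈ L, ‖y - c‖ ≥ s√n} ρ_s(y - c) ≤ (1+ε)/(1-ε) · 2⁻ⁿ · ρ_{s,c}(L)`. Proof as printed (p. 15, after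
scaling): the numerator is at most `2⁻ⁿ ρ_s(L)` by Banaszczyk's Lemma 2.10 (shifted form,
`tsum_indicator_gaussianFunction_sub_le` with `√(2πe)e^{-π} ≤ 1/2`), and `ρ_s(L) ≤ (1+ε)/(1-ε) ρ_{s,c}(L)`
by Poisson summation above `η_ε`. [cite: MicciancioRegev2007, Lemma 4.4] -/
theorem tsum_indicator_gaussianFunction_sub_le_of_smoothingParameter_le {ε s : ℝ} (hε : 0 < ε) (hε1 : ε < 1)
    (hs : 0 < s) (hηs : smoothingParameter L ε ≤ s) (c : V) :
    ∑' y : L, {y : L | s * Real.sqrt (finrank ℝ V) ≤ ‖(y : V) - c‖}.indicator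
        (fun y ↦ gaussianFunction s ((y : V) - c)) y ≤
      (1 + ε) / (1 - ε) * (2⁻¹ : ℝ) ^ finrank ℝ V * ∑' y : L, gaussianFunction s ((y : V) - c) := by
  have h1 : 1 / Real.sqrt (2 * π) ≤ 1 := by
    rw [div_le_one (Real.sqrt_pos.2 (by positivity))]
    exact Real.one_le_sqrt.2 (by linarith [Real.pi_gt_three])
  have hB := tsum_indicator_gaussianFunction_sub_le L hs h1 c
  simp only [one_mul, one_pow, mul_one] at hB
  have hC : (Real.sqrt (2 * π * Real.exp 1) * Real.exp (-π)) ^ finrank ℝ V ≤ (2⁻¹ : ℝ) ^ finrank ℝ V :=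
    pow_le_pow_left₀ (by positivity) sqrt_two_pi_e_mul_exp_neg_pi_le _
  have hρ0 : 0 ≤ ∑' y : L, gaussianFunction s (y : V) := tsum_nonneg fun _ ↦ (gaussianFunction_pos _ _).le
  have hshift := tsum_gaussianFunction_le_div_mul_tsum_sub L hε hε1 hs hηs c
  have hq : 0 ≤ (1 + ε) / (1 - ε) := div_nonneg (by linarith) (by linarith)
  calc _ ≤ (Real.sqrt (2 * π * Real.exp 1) * Real.exp (-π)) ^ finrank ℝ V * ∑' y : L, gaussianFunction s (y : V) := hB
    _ ≤ (2⁻¹ : ℝ) ^ finrank ℝ V * ∑' y : L, gaussianFunction s (y : V) := mul_le_mul_of_nonneg_right hC hρ0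
    _ ≤ (2⁻¹ : ℝ) ^ finrank ℝ V * ((1 + ε) / (1 - ε) * ∑' y : L, gaussianFunction s ((y : V) - c)) :=
        mul_le_mul_of_nonneg_left hshift (by positivity)
    _ = _ := by ring

/-! ### Expectations under `D_{L,s,c}` and MR07 Lemma 4.4, probability form -/

omit [MeasurableSpace V] [BorelSpace V] [IsZLattice ℝ L] in
/-- **The weights of `D_{L,s,c}`**: `D_{L,s,c}(x) = ρ_s(x - c) / ρ_{s,c}(L)` (as a real number), for
`0 < s`. [cite: MicciancioRegev2007, §2 (eq. (6), p. 8)] -/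
theorem discreteGaussian_toReal {s : ℝ} (hs : 0 < s) (c : V) (x : L) :
    (discreteGaussian L s c x).toReal =
      gaussianFunction s ((x : V) - c) / ∑' y : L, gaussianFunction s ((y : V) - c) := by
  rw [discreteGaussian_apply _ hs, gaussianMass_coe_eq_ofReal_tsum _ hs.ne', ENNReal.toReal_mul, ENNReal.toReal_inv,
    ENNReal.toReal_ofReal (gaussianFunction_pos _ _).le,
    ENNReal.toReal_ofReal (tsum_nonneg fun _ ↦ (gaussianFunction_pos _ _).le), div_eq_mul_inv]

/-- **Expectations under `D_{L,s,c}` are normalised Gaussian series**: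
`E_{x ∼ D_{L,s,c}}[g(x)] = (∑_{x ∈ L} ρ_s(x - c) g(x)) / ρ_{s,c}(L)` for bounded `g` and `0 < s`.
[cite: MicciancioRegev2007, §2 (eq. (6), p. 8)] -/
theorem integral_discreteGaussian_eq {s : ℝ} (hs : 0 < s) (c : V) {g : L → ℝ} {M : ℝ} (hg : ∀ x, |g x| ≤ M) :
    ∫ x, g x ∂(discreteGaussian L s c).toMeasure =
      (∑' x : L, gaussianFunction s ((x : V) - c) * g x) / ∑' x : L, gaussianFunction s ((x : V) - c) := by
  have hint : Integrable g (discreteGaussian L s c).toMeasure :=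
    (memLp_of_bounded (a := -M) (b := M) (Filter.Eventually.of_forall fun x ↦ abs_le.1 (hg x))
      (measurable_of_countable g).aestronglyMeasurable 1).integrable le_rfl
  rw [PMF.integral_eq_tsum _ g hint]
  simp_rw [discreteGaussian_toReal L hs c, smul_eq_mul, div_mul_eq_mul_div]
  rw [tsum_div_const]

/-- The probability of a set under `D_{L,s,c}`, as a normalised Gaussian series over the set (`0 < s`).
[cite: MicciancioRegev2007, §2 (eq. (6), p. 8)] -/
theorem measureReal_discreteGaussian_eq {s : ℝ} (hs : 0 < s) (c : V) (S : Set L) :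
    (discreteGaussian L s c).toMeasure.real S =
      (∑' x : L, gaussianFunction s ((x : V) - c) * S.indicator 1 x) /
        ∑' x : L, gaussianFunction s ((x : V) - c) := by
  rw [← integral_indicator_one (Set.to_countable S).measurableSet]
  exact integral_discreteGaussian_eq L hs c (M := 1) fun x ↦ by
    simp only [Set.indicator, Pi.one_apply]; split_ifs <;> simp

/-- **Micciancio–Regev 2007, Lemma 4.4 (probability form)**: for a full-rank lattice `L` in
dimension `n`, `0 < ε < 1`, `0 < s` with `η_ε(L) ≤ s`, and any centre `c`,
`Pr_{x ∼ D_{L,s,c}}[‖x - c‖ ≥ s√n] ≤ (1+ε)/(1-ε) · 2⁻ⁿ` (printed with the event `> s√n`, which is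
contained in the event bounded here). [cite: MicciancioRegev2007, Lemma 4.4] -/
theorem measureReal_discreteGaussian_norm_sub_ge_le {ε s : ℝ} (hε : 0 < ε) (hε1 : ε < 1) (hs : 0 < s)
    (hηs : smoothingParameter L ε ≤ s) (c : V) :
    (discreteGaussian L s c).toMeasure.real {x : L | s * Real.sqrt (finrank ℝ V) ≤ ‖(x : V) - c‖} ≤
      (1 + ε) / (1 - ε) * (2⁻¹ : ℝ) ^ finrank ℝ V := by
  have hZ : 0 < ∑' x : L, gaussianFunction s ((x : V) - c) := tsum_gaussianFunction_sub_pos L hs.ne' c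
  rw [measureReal_discreteGaussian_eq L hs c, div_le_iff₀ hZ]
  have h := tsum_indicator_gaussianFunction_sub_le_of_smoothingParameter_le L hε hε1 hs hηs c
  refine le_trans (le_of_eq (tsum_congr fun x ↦ ?_)) h
  simp only [Set.indicator, Set.mem_setOf_eq, Pi.one_apply]
  split_ifs <;> simp

end Literature.Algebra.EuclideanLattices

end
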